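import Summits.QuantumFields.YangMills.Theorems.AlphaInputsT3ACv3SymAvgBlockSum69
import Summits.QuantumFields.YangMills.Theorems.AlphaInputsT3ACv3SymAvgGaugeClamp
import Summits.QuantumFields.YangMills.Theorems.AlphaInputsT3ACv3LinearLiftMatrixLift
import HarnessLib

/-!
# `AlphaInputsT3ACv3SymAvgSixtyNine` — (O″χ) block B1, the (α) seam re-read as (69)_sym ∕ (71)_sym (★★OWNER RULING g26-№14 (c), R-ii): **THE ASSEMBLY of pieces (i)–(iv)** —
# [Balaban1985UV3] (69) for the SYMMETRIC (0.4)-average of record and a READ-regular finest field: if every fine plaquette with all corners in `Δ′(p′)` (the four `j`-blocks under the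
# coarse plaquette `p′`, `Carriers.plaqCover p′`) satisfies `‖U(∂q) − 1‖ ≤ a`, then
# `|Ū^{(j)}(∂p′) − 1| ≤ blockSum (L^j) (L^j•zOf p′) μ ν (dev (liftCfg 𝔊 U) μ ν) + b`, `b = (13 + (4·324L(d+2)² + 52)·4N⁴(d+1)²)·((d+2)·L^{2j}·a)²` — with the (68) radius
# `a = ½C68·g_jp(g_j)·L^{−2j}` the remainder is `C₂·(g_jp(g_j))²`, `j`-FREE, no `κ` — lane `pub-balaban3d` ∕ cell `ym3-torus`, width seat `ym-ust-19936-w7` (g3)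

WHY (cell `ym3-torus` bus 2026-08-28: ★★OWNER RULING g26-№14 (c); LEAD ★w1-19936 g3 07:56:54Z ∕ B1 PLAN v3 (2) «(69)_sym = ★w6 g2 (i) · ★w2 g4 (ii) · ★w7 g3 (iii)(iv) — target shape
`v_sym ≤ blockSum (L^j) ((L^j:ℕ)•z₀) μ ν (dev (liftCfg U) μ ν) + b`, `b ≤ C₂·(g_jp)²`»; ★w6-19936 g2 LOCATE `LOCATE-alpha-seam-w6-g2.md` §2).  The four pieces are in the tree:
(i) ✓ `LinAvgIterFluxRigid.curl_iterLinAvg_eq_rigidFlux_offsets` (★w6 g2), (ii) ✓ `SymAvgGaugeClamp.exists_clamp_expansion` (★w2 g4: the box axial gauge on `Δ′(p′)` clamped to `1`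
outside, a GLOBALLY `δ`-small copy `Ũ` with the same `v_sym` and the same fine plaquette norms on `Δ′(p′)`, `δ = (d+2)·L^j·a`), (iii)+(iv)+knit ✓ `SymAvgBlockSum69.dist1_plaqHol_iter_le_blockSum`
(this seat: (69) for a globally `δ`-small field, in the `blockSum`∕`dev`∕`liftCfg` letters).  THIS FILE composes them: apply the knit to `Ũ` at the concrete linearised family
`Q := linAvgIterM` (✓ `LinearLiftMatrix`), and transport both sides back to `U` — the left by (ii)'s `v_sym` equality, the right termwise, because every fine plaquette of the rigid family
`z_{r,a,b} = runSite (runSite (fibreSite 0 j p′.src r) μ a) ν b` has all its corners in `Δ′(p′)` (§1, by ★w2 g4's ✓ `SymAvgCover.mem_plaqsIn_cover_of_offset`).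
WHAT (def-free).  §1 `runSite_runSite_fibreSite_apply` (coordinates of the rigid family), ★ `mem_plaqsIn_cover_rigid` (the rigid family lies in `plaqsIn 0 (plaqCover p′)`),
`blockSum_dev_liftCfg_congr_of_cover` (two fields with the same plaquette deviations on `plaqsIn 0 (plaqCover p′)` have the same (69) block sum); §2 ★★★ `dist1_plaqHol_iter_le_blockSum_of_cover`
(the title statement; `SU(N)` on the tori of a `Scales`, any `GroupModel` reading; windows VERBATIM those of ✓ `exists_clamp_expansion` plus `(d+2)·L^j·a ≤ 1`).
HONEST FRAMING.  Composition of landed kernel theorems; the constants are explicit and NOT optimised; the (71)_sym knit to the v4 package's `h71` row (LEAD) and the window line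
`b ≤ C₂(g_jp)²` ∕ `hsmall` on the record are NOT here; nothing of [Balaban1985UV3] (69)–(71) is asserted beyond these letters; the seam row, B1, the stub `stub_laneRecordsV3Chi`, the crux
`HistoryTailL` and any gap are NOT closed; count-neutral helper (`--supports stmt-QuantumFields-19936`); registry untouched.  YM₃ on the three-torus is rung R3 of the programme
(finite-torus SU(2)), not the Clay problem: nothing here is about d = 4, infinite volume, the continuum, or a mass gap.

References: T. Bałaban, Commun. Math. Phys. 102 (1985) 255–275 [Balaban1985UV3] ((67)–(71) p.273); Commun. Math. Phys. 98 (1985) 17–51 [Balaban1985Averaging] ((2) p.17, (9) p.19, Prop. 2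
(52)–(54) p.26, Prop. 4 (134)–(135) p.38).
-/

set_option autoImplicit false

noncomputable section

open scoped Matrix.Norms.L2Operator BigOperators

namespace Summit.QuantumFields.YangMills.Theorems.SymAvgSixtyNine

open Finset
open Literature.MathematicalPhysics.QuantumFieldTheory.Balaban1983to89
open Literature.MathematicalPhysics.QuantumFieldTheory.Balaban1985CMP102.Setting
open Literature.MathematicalPhysics.QuantumFieldTheory.Balaban1983to89.B10Eq38TorusDomains (plaqsIn)
open T4Continuum AveragingRT BlockAveraging ExpMeanLog BlockAveragingEMLLinearised LatticeFieldCalculus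
open B10Eq70Squaring (side)
open Summit.QuantumFields.Balaban3D.Carriers (plaqCover)
open Summit.QuantumFields.Balaban3D.Proofs.LiftBridge (liftCfg)
open Summit.QuantumFields.Balaban3D.Proofs.TorusLift (zOf)
open Summit.QuantumFields.YangMills.Theorems.BalabanUVNodesN08AlphaRegSel (plaqVar)
open Summit.QuantumFields.YangMills.Theorems.SymAvgCover (mem_plaqsIn_cover_of_offset)
open Summit.QuantumFields.YangMills.Theorems.SymAvgGaugeClamp (exists_clamp_expansion)
open Summit.QuantumFields.YangMills.Theorems.SymAvgBlockSum69 (blockSum_dev_liftCfg_eq dist1_plaqHol_iter_le_blockSum)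
open Summit.QuantumFields.YangMills.Theorems.LinearLiftMatrix (linAvgIterM linAvgIterM_zero linAvgIterM_succ)
open Summit.QuantumFields.YangMills.Theorems.PerturbedPlaquette (dist1_SU_eq)

/-! ## §1 The rigid family of piece (i) lies over the cover `Δ′(p′)` -/

section Cover

variable {P : Params} {j : ℕ}

/-- Coordinates of the rigid family: `(L^j·y + r + a e_μ + b e_ν)_κ = y_κ·L^j + (r_κ + [κ = μ]·a + [κ = ν]·b)` (`μ ≠ ν`). [cite: Balaban1985Averaging, (2) p.17] -/
theorem runSite_runSite_fibreSite_apply {μ ν : Fin P.d} (hμν : μ ≠ ν) (y : Site P j) (r : Fin P.d → Fin (P.L ^ j)) (a b : ℕ) (κ : Fin P.d) :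
    (runSite (runSite (Site.fibreSite 0 j y r) μ a) ν b) κ =
      ((((y κ).val * P.L ^ j + (r κ + (if κ = μ then a else 0) + (if κ = ν then b else 0)) : ℕ)) : ZMod (P.sitesPerDir 0)) := by
  have hf : ∀ κ', Site.fibreSite 0 j y r κ' = ((((y κ').val * P.L ^ j + r κ' : ℕ)) : ZMod (P.sitesPerDir 0)) := fun _ => rfl
  simp only [runSite]
  by_cases hκν : κ = ν
  · subst hκν
    rw [Function.update_self, Function.update_of_ne (Ne.symm hμν), hf, if_neg (Ne.symm hμν), if_pos rfl]
    push_cast; ring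
  · rw [Function.update_of_ne hκν, if_neg hκν]
    by_cases hκμ : κ = μ
    · subst hκμ
      rw [Function.update_self, hf, if_pos rfl]
      push_cast; ring
    · rw [Function.update_of_ne hκμ, hf, if_neg hκμ]
      push_cast; ring

/-- **★ THE RIGID FAMILY LIES OVER THE COVER**: for `r ∈ {0,…,L^j−1}^d` and `a, b < L^j`, the fine plaquette at `L^j·p′.src + r + a e_μ + b e_ν` in the directions of `p′` has all four corners in
`Δ′(p′) = plaqCover p′`, i.e. lies in `plaqsIn 0 (plaqCover p′)` — print's «`p ⊂ (p′)_x`, `x ∈ B^j(x₀)`» are sub-plaquettes of `Δ′`. [cite: Balaban1985UV3, (69)–(70) p.273] -/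
theorem mem_plaqsIn_cover_rigid (hj : j ≤ P.m + P.K) (p : Plaq P j) (r : Fin P.d → Fin (P.L ^ j)) {a b : ℕ} (ha : a < P.L ^ j) (hb : b < P.L ^ j) :
    (⟨runSite (runSite (Site.fibreSite 0 j p.src r) p.μ a) p.ν b, p.μ, p.ν, p.hμν⟩ : Plaq P 0) ∈ plaqsIn 0 (plaqCover p) := by
  have hμν : p.μ ≠ p.ν := ne_of_lt p.hμν
  refine mem_plaqsIn_cover_of_offset hj p _ (fun κ => r κ + (if κ = p.μ then a else 0) + (if κ = p.ν then b else 0))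
    (fun κ => runSite_runSite_fibreSite_apply hμν p.src r a b κ) fun κ => ?_
  have hr : (r κ : ℕ) < P.L ^ j := (r κ).isLt
  dsimp only
  unfold side
  by_cases h1 : κ = p.μ
  · subst h1
    rw [if_pos rfl, if_neg hμν, if_pos (Or.inl rfl), if_pos (Or.inl rfl)]
    omega
  · by_cases h2 : κ = p.ν
    · subst h2
      rw [if_neg h1, if_pos rfl, if_pos (Or.inr rfl), if_pos (Or.inr rfl)]
      omega
    · rw [if_neg h1, if_neg h2, if_neg (not_or.mpr ⟨h1, h2⟩), if_neg (not_or.mpr ⟨h1, h2⟩)]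
      omega

variable {L : ℕ} {S : Scales L} {G : Type} [GaugeGroup G] [MeasurableSpace G] (𝔊 : GroupModel G)

/-- **TWO FIELDS WITH THE SAME PLAQUETTE DEVIATIONS ON `Δ′(p′)` HAVE THE SAME (69) BLOCK SUM** (the block sum reads only the rigid family, which lies over the cover).
[cite: Balaban1985UV3, (69)–(70) p.273] -/
theorem blockSum_dev_liftCfg_congr_of_cover {j : ℕ} (hj : j ≤ S.P.m + S.P.K) (p : Plaq S.P j) (U U' : GaugeField S.P 0 G)
    (h : ∀ q ∈ plaqsIn 0 (plaqCover p), dist1 (GaugeField.plaqHol U' q) = dist1 (GaugeField.plaqHol U q)) :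
    B10Eq70Squaring.blockSum (S.P.L ^ j) ((S.P.L ^ j : ℕ) • zOf p) p.μ p.ν (B10Eq70Squaring.dev (liftCfg 𝔊 U') p.μ p.ν) =
      B10Eq70Squaring.blockSum (S.P.L ^ j) ((S.P.L ^ j : ℕ) • zOf p) p.μ p.ν (B10Eq70Squaring.dev (liftCfg 𝔊 U) p.μ p.ν) := by
  rw [blockSum_dev_liftCfg_eq 𝔊 p p.μ p.ν U', blockSum_dev_liftCfg_eq 𝔊 p p.μ p.ν U]
  congr 1
  refine Finset.sum_congr rfl fun r _ => Finset.sum_congr rfl fun a ha => Finset.sum_congr rfl fun b hb => ?_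
  exact h _ (mem_plaqsIn_cover_rigid hj p r (Finset.mem_range.mp ha) (Finset.mem_range.mp hb))

end Cover

/-! ## §2 (69) for the symmetric average of a read-regular field -/

section Main

variable {L : ℕ} {S : Scales L}

/-- **★★★ [Balaban1985UV3] (69) FOR THE SYMMETRIC (0.4)-AVERAGE OF RECORD, READ-REGULAR FIELD** (`SU(N)` on the tori of a `Scales`, any `GroupModel` reading of the lift).  Let `p′` be a
level-`j` plaquette (`j + 1 ≤ m + K`, `d + 2 ≤ L`), `U` a finest field whose fine plaquettes with all corners in `Δ′(p′) = plaqCover p′` satisfy `‖U(∂q) − 1‖ ≤ a` ((68) read on the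
four blocks), put `δ := (d+2)·L^j·a ≤ 1`, `m_s := 2N²(d+1)·L^s·δ`, and assume the ONE window of [Balaban1985Averaging] Prop. 4 at the flat gauge, `324L(d+2)²·m_j ≤ 1`, `4(d+2)L·m_j < δ_N`.
Then  `|Ū^{(j)}(∂p′) − 1| ≤ Σ_{x∈B^j(x₀)} L^{−dj} Σ_{p⊂(p′)_x} |(lift U)(∂p) − 1| + (13·(L^jδ)² + (4·324L(d+2)² + 52)·m_j²)`, the sum being LQB's `blockSum (L^j) (L^j•zOf p′) μ ν
(dev (liftCfg 𝔊 U) μ ν)`.  Proof: (ii) gives a globally `δ`-small `Ũ` with the same left side and the same plaquette deviations on `Δ′(p′)`; the knit (i)+(iii)+(iv) bounds `Ũ`'s left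
side by `Ũ`'s block sum + remainder; §1 identifies the two block sums. [cite: Balaban1985UV3, (67)–(69) p.273; Balaban1985Averaging, Prop. 2 (52)–(54) p.26, Prop. 4 (134)–(135) p.38] -/
theorem dist1_plaqHol_iter_le_blockSum_of_cover {N : ℕ} [NeZero N] (𝔊 : GroupModel (Matrix.specialUnitaryGroup (Fin N) ℂ))
    (hL : S.P.d + 2 ≤ S.P.L) {j : ℕ} (hj : j + 1 ≤ S.P.m + S.P.K) (p : Plaq S.P j)
    (U : GaugeField S.P 0 (Matrix.specialUnitaryGroup (Fin N) ℂ)) {a : ℝ} (ha : 0 ≤ a)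
    (hU : ∀ q ∈ plaqsIn 0 (plaqCover p), ‖((GaugeField.plaqHol U q : Matrix.specialUnitaryGroup (Fin N) ℂ) : Matrix (Fin N) (Fin N) ℂ) - 1‖ ≤ a)
    (hδ1 : ((S.P.d : ℝ) + 2) * (S.P.L : ℝ) ^ j * a ≤ 1)
    (hm : 324 * (S.P.L : ℝ) * ((S.P.d : ℝ) + 2) ^ 2 *
      (2 * (Fintype.card (Fin N) : ℝ) ^ 2 * (((S.P.d : ℝ) + 1) * (S.P.L : ℝ) ^ j * (((S.P.d : ℝ) + 2) * (S.P.L : ℝ) ^ j * a))) ≤ 1)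
    (hN : 4 * (((S.P.d + 2) * S.P.L : ℕ) : ℝ) *
      (2 * (Fintype.card (Fin N) : ℝ) ^ 2 * (((S.P.d : ℝ) + 1) * (S.P.L : ℝ) ^ j * (((S.P.d : ℝ) + 2) * (S.P.L : ℝ) ^ j * a))) < deltaSU (Fin N)) :
    GaugeGroup.dist1 (GaugeField.plaqHol (Averaging.iter (fun i => blockAvg (P := S.P) (j := i) (expMeanLogSU (n := Fin N))) j U) p) ≤
      B10Eq70Squaring.blockSum (S.P.L ^ j) ((S.P.L ^ j : ℕ) • zOf p) p.μ p.ν (B10Eq70Squaring.dev (liftCfg 𝔊 U) p.μ p.ν) +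
      (13 * ((S.P.L : ℝ) ^ j * (((S.P.d : ℝ) + 2) * (S.P.L : ℝ) ^ j * a)) ^ 2 +
        (4 * (324 * (S.P.L : ℝ) * ((S.P.d : ℝ) + 2) ^ 2) + 52) *
          (2 * (Fintype.card (Fin N) : ℝ) ^ 2 * (((S.P.d : ℝ) + 1) * (S.P.L : ℝ) ^ j * (((S.P.d : ℝ) + 2) * (S.P.L : ℝ) ^ j * a))) ^ 2) := by
  have hjK : j ≤ S.P.m + S.P.K := by omega
  have hδ : 0 ≤ ((S.P.d : ℝ) + 2) * (S.P.L : ℝ) ^ j * a := by positivity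
  -- piece (ii): the clamp
  obtain ⟨v, Ut, -, -, hsmall, -, hplaq, -, -, hvsym, -⟩ :=
    exists_clamp_expansion (P := S.P) (linAvgIterM (P := S.P) (n := Fin N)) (fun Y => linAvgIterM_zero Y) (fun s Y c => linAvgIterM_succ s Y c)
      hL hj p U ha hU hm hN
  -- the knit (i)+(iii)+(iv) for the globally small copy
  have hknit := dist1_plaqHol_iter_le_blockSum 𝔊 (linAvgIterM (P := S.P) (n := Fin N)) (fun Y => linAvgIterM_zero Y) (fun s Y c => linAvgIterM_succ s Y c)
    hL Ut hδ hδ1 hsmall j hm hN j le_rfl hjK p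
  -- transport the left side
  have hleft : GaugeGroup.dist1 (GaugeField.plaqHol (Averaging.iter (fun i => blockAvg (P := S.P) (j := i) (expMeanLogSU (n := Fin N))) j U) p) =
      GaugeGroup.dist1 (GaugeField.plaqHol (Averaging.iter (fun i => blockAvg (P := S.P) (j := i) (expMeanLogSU (n := Fin N))) j Ut) p) := by
    rw [dist1_SU_eq, dist1_SU_eq]
    exact hvsym
  -- transport the right side
  have hright := blockSum_dev_liftCfg_congr_of_cover 𝔊 hjK p U Ut fun q hq => by
    rw [dist1_SU_eq, dist1_SU_eq]; exact hplaq q hq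
  rw [hleft, ← hright]
  exact hknit

end Main

end Summit.QuantumFields.YangMills.Theorems.SymAvgSixtyNine

end
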